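import Summits.ValiantsHypothesis.ValiantsHypothesis.Theses.FeketeSOS
import Literature.NumberTheory.LFunctions.FeketePolynomial

/-!
# `FeketeNoSparseSplit` (crux stmt-ValiantsHypothesis-3997): small models and the peel mechanism —
tightness of `(p+3)/2`, trivial splittings are not (eventually) optimal, and the modulus must be prime

Negative-side facts (cdisprove, refuter-cdisprove-stmt-ValiantsHypothesis-3997-0), all PROVED:
* `tight_at_three`, `tight_at_five` — the linear bound `(p+3)/2` of the line `cyclic-valuation-dichotomy`
  is ATTAINED at `p = 3` (`F_3 = X·(1-X)`) and `p = 5` (`F_5 = (X-X²)(1-X²)`); exhaustive search over all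
  complex splittings shows it is NOT attained for `7 ≤ p ≤ 29` (minima `7,9,10,14,15,23,22`).
* `not_trivialSplittingOptimal` — the natural strengthening "every splitting has support-sum `≥ p`"
  (trivial splittings optimal) is FALSE (`p = 5`); `peel_at_eleven` (`9 < 11`).
* THE PEEL MECHANISM in general (the only sub-generic one in all exhaustive data):
  `X_sub_X_sq_mul_peelCofactor` — `F_p = (X - X²)·Σ_{k<p-2} S_p(k+1) X^k` over `ℤ` for every odd prime,
  `S_p(k) = Σ_{m≤k} (m|p)`; `peel_split` — hence `min(|supp A|+|supp B|) ≤ 2 + #{1 ≤ k ≤ p-2 : S_p(k) ≠ 0}`;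
  `sum_half_legendreSym_eq_zero` (`p ≡ 1 (4)` ⇒ `S_p((p-1)/2) = 0`) and `peel_split_one_mod_four`
  (support-sum `≤ p - 1`); so `not_eventuallyTrivialOptimal`: even `∃ p₀ ∀ primes p ≥ p₀, min ≥ p` is
  FALSE (primes `≡ 1 (4)` from `Nat.exists_prime_gt_modEq_one`).
* `jacobi_fifteen_split` — for the Jacobi analogue `Σ_{m<N} (m|N) X^m` the bound `(N+3)/2` FAILS at
  `N = 15`: `F_15 = (X - X⁶)(1 + X + X³ + X⁵ + X⁷ + X⁸)`, support-sum `8 < 9` (`X^q - 1 ∣ F_{pq}`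
  always); primality of the modulus is load-bearing for the char-`p` multiplicity lever.
Elementary; uses the tree's `Literature.NumberTheory.LFunctions.feketePolynomial` API
(`sum_range_legendreSym`, `map_feketePolynomial_complex`, `legendreSym_natCast_sub`); no new facts.
-/

namespace Summit.ValiantsHypothesis.Theorems.FeketeNoSparseSplit.Negative

open Polynomial Finset
open Literature.NumberTheory.LFunctions

/-! ## §B  Tightness of the line's bound `(p+3)/2`; trivial splittings are not optimal -/

/-- `5` is prime (local instance). [folklore] -/
theorem fact_prime_five : Fact (Nat.Prime 5) := ⟨by norm_num⟩
/-- `11` is prime (local instance). [folklore] -/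
theorem fact_prime_eleven : Fact (Nat.Prime 11) := ⟨by norm_num⟩
attribute [local instance] fact_prime_five fact_prime_eleven

/-- `F_3 = X - X²`. [folklore] -/
theorem fekete_three_eq :
    (∑ m ∈ Finset.range 3, C ((legendreSym 3 m : ℤ) : ℂ) * X ^ m) = X - X ^ 2 := by
  simp [Finset.sum_range_succ]
  norm_num
  ring

/-- `F_5 = X - X² - X³ + X⁴`. [folklore] -/
theorem fekete_five_eq :
    (∑ m ∈ Finset.range 5, C ((legendreSym 5 m : ℤ) : ℂ) * X ^ m) = X - X ^ 2 - X ^ 3 + X ^ 4 := by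
  simp [Finset.sum_range_succ]
  norm_num
  ring

/-- `F_11` explicitly (quadratic residues mod 11: `1,3,4,5,9`). [folklore] -/
theorem fekete_eleven_eq :
    (∑ m ∈ Finset.range 11, C ((legendreSym 11 m : ℤ) : ℂ) * X ^ m) =
      X - X ^ 2 + X ^ 3 + X ^ 4 + X ^ 5 - X ^ 6 - X ^ 7 - X ^ 8 + X ^ 9 - X ^ 10 := by
  simp [Finset.sum_range_succ]
  norm_num
  ring

/-- `X - X²` has two monomials. [folklore] -/
theorem card_support_X_sub_X_sq : ((X - X ^ 2 : ℂ[X])).support.card = 2 := by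
  have : (X - X ^ 2 : ℂ[X]) = C 1 * X ^ 1 + C (-1) * X ^ 2 := by simp; ring
  rw [this, card_support_binomial (by norm_num) (by norm_num) (by norm_num)]

/-- `1 - X²` has two monomials. [folklore] -/
theorem card_support_one_sub_X_sq : ((1 - X ^ 2 : ℂ[X])).support.card = 2 := by
  have : (1 - X ^ 2 : ℂ[X]) = C 1 * X ^ 0 + C (-1) * X ^ 2 := by simp; ring
  rw [this, card_support_binomial (by norm_num) (by norm_num) (by norm_num)]

/-- `1 - X` has two monomials. [folklore] -/
theorem card_support_one_sub_X : ((1 - X : ℂ[X])).support.card = 2 := by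
  have : (1 - X : ℂ[X]) = C 1 * X ^ 0 + C (-1) * X ^ 1 := by simp; ring
  rw [this, card_support_binomial (by norm_num) (by norm_num) (by norm_num)]

/-- `p = 3`: the line's bound `(p+3)/2 = 3` is attained, `F_3 = X·(1 - X)`. [folklore] -/
theorem tight_at_three : ∃ A B : ℂ[X],
    A * B = ∑ m ∈ Finset.range 3, C ((legendreSym 3 m : ℤ) : ℂ) * X ^ m ∧
    A.support.card + B.support.card = (3 + 3) / 2 := by
  refine ⟨X, 1 - X, ?_, ?_⟩
  · rw [fekete_three_eq]; ring
  · rw [card_support_one_sub_X, support_X, Finset.card_singleton]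

/-- `p = 5`: the line's bound `(p+3)/2 = 4` is attained, `F_5 = (X - X²)(1 - X²)` — the last prime at which
it is tight in the exhaustive data (`p = 7, …, 29`: minima `7,9,10,14,15,23,22 > (p+3)/2`). [folklore] -/
theorem tight_at_five : ∃ A B : ℂ[X],
    A * B = ∑ m ∈ Finset.range 5, C ((legendreSym 5 m : ℤ) : ℂ) * X ^ m ∧
    A.support.card + B.support.card = (5 + 3) / 2 := by
  refine ⟨X - X ^ 2, 1 - X ^ 2, ?_, ?_⟩
  · rw [fekete_five_eq]; ring
  · rw [card_support_X_sub_X_sq, card_support_one_sub_X_sq]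

/-- NATURAL STRENGTHENING REFUTED: "trivial splittings are optimal", i.e. `p ≤ |supp A| + |supp B|` for
every prime `p` and every splitting, fails (already at `p = 5`; also at `p = 11, 13, 17, 19, 29` by the
`(x∓1)`-peel, see `peel_at_eleven`). [folklore] -/
theorem not_trivialSplittingOptimal :
    ¬ ∀ (p : ℕ) [Fact p.Prime] (A B : ℂ[X]),
      A * B = ∑ m ∈ Finset.range p, C ((legendreSym p m : ℤ) : ℂ) * X ^ m →
        (p : ℝ) ≤ (A.support.card : ℝ) + (B.support.card : ℝ) := by
  intro H
  obtain ⟨A, B, hAB, hcard⟩ := tight_at_five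
  have h := H 5 A B hAB
  have h' : ((A.support.card : ℝ) + (B.support.card : ℝ)) = 4 := by
    norm_num at hcard; exact_mod_cast hcard
  have h5 : ((5 : ℕ) : ℝ) = 5 := by norm_num
  linarith

/-- The peel cofactor at `p = 11`: the partial sums `S_11(k) = (1,0,1,2,3,2,1,0,1)` of the Legendre
symbols mod 11, as a 7-term polynomial. [folklore] -/
noncomputable def Q11 : ℂ[X] :=
  ∑ i : Fin 7, C ((![1, 1, 2, 3, 2, 1, 1] : Fin 7 → ℂ) i) * X ^ ((![0, 2, 3, 4, 5, 6, 8] : Fin 7 → ℕ) i)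

/-- `Q11` has exactly seven monomials. [folklore] -/
theorem Q11_card : Q11.support.card = 7 := by
  unfold Q11
  apply card_support_eq'
  · decide
  · intro i; fin_cases i <;> norm_num

/-- `Q11 = 1 + X² + 2X³ + 3X⁴ + 2X⁵ + X⁶ + X⁸`. [folklore] -/
theorem Q11_eq : Q11 = 1 + X ^ 2 + 2 * X ^ 3 + 3 * X ^ 4 + 2 * X ^ 5 + X ^ 6 + X ^ 8 := by
  unfold Q11
  simp [Fin.sum_univ_succ]
  simp only [map_ofNat]
  ring

/-- `p = 11`: the `(X-1)`-peel `F_11 = (X - X²)·Σ_k S_11(k+1) X^k` has support-sum `2 + 7 = 9 < 11`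
(the exhaustive minimum at `p = 11`; two of the nine partial sums vanish). [folklore] -/
theorem peel_at_eleven : ∃ A B : ℂ[X],
    A * B = ∑ m ∈ Finset.range 11, C ((legendreSym 11 m : ℤ) : ℂ) * X ^ m ∧
    A.support.card + B.support.card = 9 := by
  refine ⟨X - X ^ 2, Q11, ?_, ?_⟩
  · rw [fekete_eleven_eq, Q11_eq]; ring
  · rw [card_support_X_sub_X_sq, Q11_card]

section Peel

variable (p : ℕ) [Fact p.Prime]

/-- The peel cofactor: partial sums `S_p(k+1) = Σ_{m ≤ k+1} (m|p)` as coefficients. [folklore] -/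
noncomputable def peelCofactor : ℤ[X] :=
  ∑ k ∈ range (p - 2), C (∑ m ∈ range (k + 2), legendreSym p m) * X ^ k

/-- Coefficients of the peel cofactor. [folklore] -/
theorem coeff_peelCofactor (k : ℕ) :
    (peelCofactor p).coeff k = if k < p - 2 then ∑ m ∈ range (k + 2), legendreSym p m else 0 := by
  simp only [peelCofactor, finsetSum_coeff, coeff_C_mul_X_pow]
  simp [Finset.mem_range]

/-- **The `(X-1)`-peel identity** over `ℤ`: `(X - X²)·Σ_{k<p-2} S_p(k+1) X^k = F_p` for odd `p`
(coefficient of `X^n`: `S_p(n) - S_p(n-1) = χ_p(n)`, using `S_p(p-1) = Σ_{m<p} χ_p(m) = 0`). [folklore] -/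
theorem X_sub_X_sq_mul_peelCofactor (hp : p ≠ 2) :
    (X - X ^ 2) * peelCofactor p = feketePolynomial p := by
  have hprime : p.Prime := Fact.out
  have hp3 : 3 ≤ p := by have := hprime.two_le; omega
  ext n
  have h : (X - X ^ 2 : ℤ[X]) * peelCofactor p = X ^ 1 * peelCofactor p - X ^ 2 * peelCofactor p := by
    ring
  rw [h, coeff_sub, coeff_X_pow_mul', coeff_X_pow_mul', coeff_peelCofactor, coeff_peelCofactor,
    coeff_feketePolynomial]
  by_cases h0 : n = 0
  · subst h0
    simp [legendreSym.at_zero]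
  by_cases h1 : n = 1
  · subst h1
    rw [if_pos le_rfl, if_pos (by omega), if_neg (by norm_num), if_pos hprime.one_lt, sub_zero,
      show 1 - 1 + 2 = 0 + 1 + 1 by rfl, Finset.sum_range_succ, Finset.sum_range_succ, Finset.sum_range_zero]
    simp [legendreSym.at_zero]
  by_cases hle : n ≤ p - 2
  · rw [if_pos (by omega), if_pos (by omega), if_pos (by omega), if_pos (by omega), if_pos (by omega),
      show n - 1 + 2 = n + 1 by omega, show n - 2 + 2 = n by omega, Finset.sum_range_succ]
    ring
  by_cases heq : n = p - 1
  · rw [if_pos (by omega), if_neg (by omega), if_pos (by omega), if_pos (by omega), if_pos (by omega),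
      zero_sub, show n - 2 + 2 = p - 1 by omega]
    have hsum := sum_range_legendreSym p hp
    have hr : Finset.range p = Finset.range (p - 1 + 1) := by congr 1; omega
    rw [hr, Finset.sum_range_succ] at hsum
    rw [heq]
    linarith
  · rw [if_pos (by omega), if_neg (by omega), if_pos (by omega), if_neg (by omega), if_neg (by omega),
      sub_zero]

/-- The support of the peel cofactor is the set of indices of non-vanishing partial sums. [folklore] -/
theorem support_peelCofactor :
    (peelCofactor p).support =
      (range (p - 2)).filter (fun k => ∑ m ∈ range (k + 2), legendreSym p m ≠ 0) := by
  ext k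
  rw [mem_support_iff, coeff_peelCofactor, Finset.mem_filter, Finset.mem_range]
  by_cases hk : k < p - 2 <;> simp [hk]

/-- **General peel splitting**: for every odd prime `p`, `F_p = (X - X²)·B` with
`|supp B| = #{k < p-2 : S_p(k+1) ≠ 0}`; hence `min (|supp A|+|supp B|) ≤ 2 + #{1 ≤ k ≤ p-2 : S_p(k) ≠ 0}`
— the mechanism behind every sub-generic optimum in the exhaustive data. [folklore] -/
theorem peel_split (hp : p ≠ 2) : ∃ A B : ℂ[X],
    A * B = ∑ m ∈ Finset.range p, C ((legendreSym p m : ℤ) : ℂ) * X ^ m ∧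
    A.support.card = 2 ∧
    B.support.card = ((range (p - 2)).filter (fun k => ∑ m ∈ range (k + 2), legendreSym p m ≠ 0)).card := by
  refine ⟨X - X ^ 2, (peelCofactor p).map (Int.castRingHom ℂ), ?_, card_support_X_sub_X_sq, ?_⟩
  · rw [← map_feketePolynomial_complex, ← X_sub_X_sq_mul_peelCofactor p hp, Polynomial.map_mul]
    simp
  · rw [support_map_of_injective _ (RingHom.injective_int (Int.castRingHom ℂ)), support_peelCofactor]

/-- For `p ≡ 1 (mod 4)` the middle partial sum vanishes: `S_p((p-1)/2) = Σ_{m ≤ (p-1)/2} (m|p) = 0`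
(`χ_p` is even, the total sum is `0`, and the two halves agree). [folklore] -/
theorem sum_half_legendreSym_eq_zero (hp4 : p % 4 = 1) :
    ∑ m ∈ range ((p + 1) / 2), legendreSym p m = 0 := by
  have hprime : p.Prime := Fact.out
  have hp2 : p ≠ 2 := by rintro rfl; norm_num at hp4
  have hneg1 : legendreSym p (-1) = 1 := by
    rw [legendreSym.at_neg_one hp2, ZMod.χ₄_nat_one_mod_four hp4]
  obtain ⟨h, hh⟩ : ∃ h, p = 2 * h + 1 := ⟨p / 2, by omega⟩
  have hhalf : (p + 1) / 2 = h + 1 := by omega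
  have htot := sum_range_legendreSym p hp2
  have hr : Finset.range p = Finset.range ((h + 1) + h) := by congr 1; omega
  rw [hr, Finset.sum_range_add] at htot
  -- the second half equals the first half
  have hsecond : ∑ j ∈ range h, legendreSym p ((h + 1 + j : ℕ) : ℤ) = ∑ m ∈ range (h + 1), legendreSym p m := by
    have hrefl : ∑ j ∈ range h, legendreSym p ((h + 1 + j : ℕ) : ℤ)
        = ∑ j ∈ range h, legendreSym p ((p - (j + 1) : ℕ) : ℤ) := by
      rw [← Finset.sum_range_reflect (fun j => legendreSym p ((p - (j + 1) : ℕ) : ℤ)) h]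
      refine Finset.sum_congr rfl ?_
      intro j hj
      rw [Finset.mem_range] at hj
      congr 2
      omega
    rw [hrefl, Finset.sum_range_succ' (fun m => legendreSym p (m : ℤ)), Nat.cast_zero, legendreSym.at_zero,
      add_zero]
    refine Finset.sum_congr rfl ?_
    intro j hj
    rw [Finset.mem_range] at hj
    rw [legendreSym_natCast_sub p (by omega), neg_eq_neg_one_mul, legendreSym.mul, hneg1, one_mul]
  rw [hsecond] at htot
  rw [hhalf]
  linarith

/-- For every prime `p ≡ 1 (mod 4)` there is a splitting of `F_p` with support-sum `≤ p - 1 < p`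
(the peel, one partial sum vanishing): trivial splittings are NEVER optimal there. [folklore] -/
theorem peel_split_one_mod_four (hp4 : p % 4 = 1) : ∃ A B : ℂ[X],
    A * B = ∑ m ∈ Finset.range p, C ((legendreSym p m : ℤ) : ℂ) * X ^ m ∧
    A.support.card + B.support.card ≤ p - 1 := by
  have hprime : p.Prime := Fact.out
  have hp2 : p ≠ 2 := by rintro rfl; norm_num at hp4
  have hp5 : 5 ≤ p := by
    have h2 := hprime.two_le
    have : p ≠ 3 := by rintro rfl; norm_num at hp4
    have : p ≠ 4 := by rintro rfl; exact absurd hprime (by norm_num)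
    omega
  obtain ⟨A, B, hAB, hA, hB⟩ := peel_split p hp2
  refine ⟨A, B, hAB, ?_⟩
  have hsub : (range (p - 2)).filter (fun k => ∑ m ∈ range (k + 2), legendreSym p m ≠ 0)
      ⊆ (range (p - 2)).erase ((p - 3) / 2) := by
    intro k hk
    rw [Finset.mem_filter] at hk
    rw [Finset.mem_erase]
    refine ⟨?_, hk.1⟩
    rintro rfl
    apply hk.2
    have : (p - 3) / 2 + 2 = (p + 1) / 2 := by omega
    rw [this]
    exact sum_half_legendreSym_eq_zero p hp4
  have hcard := Finset.card_le_card hsub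
  rw [Finset.card_erase_of_mem (by rw [Finset.mem_range]; omega), Finset.card_range] at hcard
  omega

/-- **NATURAL STRENGTHENING REFUTED, eventual form**: `∃ p₀ ∀ primes p ≥ p₀, every splitting has
support-sum ≥ p` is FALSE (infinitely many `p ≡ 1 (mod 4)` by `Nat.exists_prime_gt_modEq_one`, and the
peel at each of them).  So the exponent-`1` constant of the crux is `< 1` infinitely often; the line gives `≥ 1/2`. [folklore] -/
theorem not_eventuallyTrivialOptimal :
    ¬ ∃ p₀ : ℕ, ∀ (p : ℕ) [Fact p.Prime], p₀ ≤ p → ∀ (A B : ℂ[X]),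
      A * B = ∑ m ∈ Finset.range p, C ((legendreSym p m : ℤ) : ℂ) * X ^ m →
        (p : ℝ) ≤ (A.support.card : ℝ) + (B.support.card : ℝ) := by
  rintro ⟨p₀, H⟩
  obtain ⟨q, hq, hgt, hmod⟩ := Nat.exists_prime_gt_modEq_one (p₀ + 4) (by norm_num : (4 : ℕ) ≠ 0)
  haveI : Fact q.Prime := ⟨hq⟩
  have hq4 : q % 4 = 1 := by
    have := hmod; unfold Nat.ModEq at this; simpa using this
  obtain ⟨A, B, hAB, hle⟩ := peel_split_one_mod_four q hq4
  have h := H q (by omega) A B hAB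
  have h' : ((A.support.card : ℝ) + (B.support.card : ℝ)) ≤ (q : ℝ) - 1 := by
    have hq1 : 1 ≤ q := hq.one_lt.le
    have : ((A.support.card + B.support.card : ℕ) : ℝ) ≤ ((q - 1 : ℕ) : ℝ) := by exact_mod_cast hle
    push_cast [Nat.cast_sub hq1] at this
    exact this
  linarith

end Peel

/-! ## §C  The modulus must be prime: the Jacobi analogue at `N = 15` beats `(N+3)/2` -/

/-- The Jacobi–Fekete polynomial of `N = 15` explicitly. [folklore] -/
theorem jacobiFekete_fifteen_eq :
    (∑ m ∈ Finset.range 15, C ((jacobiSym m 15 : ℤ) : ℂ) * X ^ m) =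
      X + X ^ 2 + X ^ 4 - X ^ 7 + X ^ 8 - X ^ 11 - X ^ 13 - X ^ 14 := by
  simp [Finset.sum_range_succ]
  norm_num
  ring

/-- The 6-term cofactor `1 + X + X³ + X⁵ + X⁷ + X⁸` of `X - X⁶` in `F_15`. [folklore] -/
noncomputable def Q15 : ℂ[X] :=
  ∑ i : Fin 6, C ((![1, 1, 1, 1, 1, 1] : Fin 6 → ℂ) i) * X ^ ((![0, 1, 3, 5, 7, 8] : Fin 6 → ℕ) i)

/-- `Q15` has exactly six monomials. [folklore] -/
theorem Q15_card : Q15.support.card = 6 := by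
  unfold Q15
  apply card_support_eq'
  · decide
  · intro i; fin_cases i <;> norm_num

/-- `Q15 = 1 + X + X³ + X⁵ + X⁷ + X⁸`. [folklore] -/
theorem Q15_eq : Q15 = 1 + X + X ^ 3 + X ^ 5 + X ^ 7 + X ^ 8 := by
  unfold Q15
  simp [Fin.sum_univ_succ]
  ring

/-- `X - X⁶` has two monomials. [folklore] -/
theorem card_support_X_sub_X_pow_six : ((X - X ^ 6 : ℂ[X])).support.card = 2 := by
  have : (X - X ^ 6 : ℂ[X]) = C 1 * X ^ 1 + C (-1) * X ^ 6 := by simp; ring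
  rw [this, card_support_binomial (by norm_num) (by norm_num) (by norm_num)]

/-- `N = 15 = 3·5`: `F_15 = (X - X⁶)·(1 + X + X³ + X⁵ + X⁷ + X⁸)`, support-sum `8 < 9 = (15+3)/2` — the
char-`p` multiplicity lever (and its bound) is specific to PRIME moduli. [folklore] -/
theorem jacobi_fifteen_split : ∃ A B : ℂ[X],
    A * B = ∑ m ∈ Finset.range 15, C ((jacobiSym m 15 : ℤ) : ℂ) * X ^ m ∧
    A.support.card + B.support.card < (15 + 3) / 2 := by
  refine ⟨X - X ^ 6, Q15, ?_, ?_⟩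
  · rw [jacobiFekete_fifteen_eq, Q15_eq]; ring
  · rw [card_support_X_sub_X_pow_six, Q15_card]; norm_num


end Summit.ValiantsHypothesis.Theorems.FeketeNoSparseSplit.Negative
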